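import Summits.QuantumFields.YangMills.Theorems.SwapVirialDeficitBlowUpGnomonicFibreRescaledSockets
import HarnessLib

/-!
# STUB S2∞ OF THE (S)-SKELETON: THE BULK FIBRED LAPLACE ESTIMATE OVER THE WHOLE BASE PLANE `ℝ²` (no gnomonic-end cut `V₀`; option E1)
# (free-hands support of ⟨stmt-QuantumFields-24197⟩ `SwapVirialDeficit.SwapGluedStiffness` ∕ ⟨24194⟩ `SwapMeanActionGap`; cell ym-idea-1, assembler fcl-p3 g47)

✓`SectorLaplace.bulk_fibred` (file ✓`…SectorLaplaceBulkStub`) estimates the BOX integral `∫_{|x₀|,|y₀| ≤ V₀}` with constants degrading like `(V₀∕ψ₀)^k` and leaves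
the gnomonic ends `|x₀| > V₀ ∨ |y₀| > V₀` to a separate stub S5c.  In the RESCALED fibre letters (✓`gnoScale`; sockets ✓`gnoFibre_rescaled_sockets`, floors
✓`fibQ_gnoScale_ge` ∕ ✓`farFloor_gnoScale`, chart identity ✓`volume_gnoDensity_restrict_scaledTube_eq_map`) every socket of the generic √b law
✓`laplaceMethod_quantitative_fibred_chart_cubic_offBound` is uniform on `ℝ²`, so the SAME estimate holds for the WHOLE good-sign fibre integral at a bulk hub:
* §1 ★★★ `bulk_fibred_plane_core` — explicit constants (`λ = ψ₀∕(82944L¹⁰)`, `A₃ = 1242000L⁴`, tube radius `R`), main term `(2π∕b)^{m∕2}·∫_{ℝ²} 𝔪(a,ε,p) dp`;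
* §2 `plane_dominator_bounds` and ★★★ `SectorLaplace.bulk_fibred_plane` — the skeleton-shaped statement: `K = 234483·82944⁸`, `k = 80`, for `0 < ψ₀ ≤ 1`,
  `(K L^k ψ₀^{−k})² ≤ b`, `a ∈ HubBulk ψ₀`, `GoodSign ε`:
  `|∫ e^{−bF̂_{a,ε}}ρ − (2π∕b)^α ∫_{ℝ²} 𝔪| ≤ K L^k ψ₀^{−k} b^{−1∕2}·(2π∕b)^α ∫_{ℝ²} 𝔪 + (∫ρ)·e^{−b(ψ₀∕(K L^k))^k}`
  (✓`Defs` letters `z₀`, `alpha`, `mbDensity`, `HubBulk`, `GoodSign`; the hub integral is written out, `hubIntegral` being a HOME-skeleton abbreviation).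
With it the assembly can take `V₀ = ∞`: stub S5c (gnomonic ends) and the `V₀^{−κ}` share disappear (g47 18:31Z, twins of S2i∕S4∕window).

HONEST LABEL: one analytic stub of the (S)-road in its V₀-free form; S3 (integrability of `𝔪` over cone × ℝ²), S4, S5a∕b, the assembly, ⟨24197⟩ ∕ ⟨24194⟩ remain OPEN;
own crux ⟨22884⟩ `LargeFieldMassRefinementTail` OPEN (blocked-on ⟨19935⟩); the Yang–Mills mass gap is NOT proved; no summit is proved by a line.  THEOREMS ONLY
(0 `def`, 0 `sorry`, no instance), standard axioms.  Width seat ym-line-sfw-p2-w2 g59 (cell ym-idea-1, free hands), `--supports stmt-QuantumFields-24197`.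
References: [cite: Luscher1983, §2]; [cite: HasenpflugRudolfSprungk2024, App. 4.1 Thm 16]; [cite: Breitung1994, Lemma 26 (2.102) p. 30]; [folklore].
-/

set_option autoImplicit false
set_option synthInstance.maxSize 1024

noncomputable section

open MeasureTheory Quaternion Set Metric Module
open scoped Quaternion BigOperators ENNReal InnerProductSpace
open Literature.MathematicalPhysics.QuantumLattice
open Literature.MathematicalPhysics.QuantumFieldTheory hiding SU2

namespace Summit.QuantumFields.YangMills.Theorems.SwapVirialDeficit.BlowUpRing

open Summit.QuantumFields.YangMills.Theorems.FemtoTransferGap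
open Summit.QuantumFields.YangMills.Theorems.FemtoTransferGap.TT
open Summit.QuantumFields.YangMills.Theorems.VirialFluxGap.RingDeficit
open Summit.QuantumFields.YangMills.Theorems.SwapVirialDeficit.SwapRing
open Summit.QuantumFields.YangMills.Theorems.SwapVirialDeficit.SectorLaplace (fibQ z₀ mbDensity alpha mbDensity_nonneg)
open Summit.QuantumFields.YangMills.Theorems.QuantitativeLaplace (laplaceMethod_quantitative_fibred_chart_cubic_offBound)

variable {L : ℕ} [NeZero L]

/-! ## §1 The plane estimate with explicit constants -/

/-- ★★★ **THE BULK FIBRED LAPLACE ESTIMATE OF SECTOR 000 OVER THE WHOLE BASE PLANE.**  Hub `a ≠ 0` in the bulk (`ψ₀ ≤ sin²2ψ`, `ψ₀ ≤ sin²ψ`, `0 < ψ₀ ≤ 1`), good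
signs; `λ := ψ₀∕(82944L¹⁰)`, `A₃ := 1242000L⁴`, `0 < R ≤ 1` with `A₃R ≤ λ∕(8(m+8))`, `2R·R ≤ 1` (`m = dim V_L`), `0 < b`.  Then with `Main := (2π∕b)^{m∕2}·∫_{ℝ²} 𝔪(a,ε,p) dp`
and `K₃ := 16A₃(m+8)∕λ + 256A₃(m+8)²∕λ² + 2R + 16R(m+8)∕λ`:
`|∫ e^{−bF̂_{a,ε}}ρ − Main| ≤ (K₃∕√b + 16(m+8)∕(λR²b))·Main + e^{−bλR²}·∫ρ` — ✓`laplaceMethod_quantitative_fibred_chart_cubic_offBound` on `M = ℝ²` in the rescaled chart.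
[cite: Luscher1983, §2] [cite: HasenpflugRudolfSprungk2024, App. 4.1 Thm 16] -/
theorem bulk_fibred_plane_core {a : ℍ} (ha : a ≠ 0) (ε : GnoSign L) (hz : ε.2.1 = true) (hε : ε.2.2 = fun _ => true)
    {ψ₀ : ℝ} (hψ₀ : 0 < ψ₀) (hψ₁ : ψ₀ ≤ 1) (hS1 : ψ₀ ≤ (2 * (‖a‖⁻¹ * a.re) * (‖a‖⁻¹ * ‖a.im‖)) ^ 2) (hS2 : ψ₀ ≤ (‖a‖⁻¹ * ‖a.im‖) ^ 2)
    {R b : ℝ} (hR : 0 < R) (hR1 : R ≤ 1)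
    (hsmall : 1242000 * (L : ℝ) ^ 4 * R ≤ ψ₀ / (82944 * (L : ℝ) ^ 10) / (8 * ((finrank ℝ (GnoFibre L) : ℝ) + 8))) (hDR : 2 * R * R ≤ 1) (hb : 0 < b) :
    |(∫ η : GnoCoord L, Real.exp (-(b * gnoDeficit (fun _ => false) (fun _ => 1) a ε η)) * gnoDensity η) -
        (2 * Real.pi / b) ^ ((finrank ℝ (GnoFibre L) : ℝ) / 2) * ∫ p : ℝ × ℝ, mbDensity a ε p| ≤
      ((16 * (1242000 * (L : ℝ) ^ 4) * ((finrank ℝ (GnoFibre L) : ℝ) + 8) / (ψ₀ / (82944 * (L : ℝ) ^ 10)) +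
              256 * (1242000 * (L : ℝ) ^ 4) * ((finrank ℝ (GnoFibre L) : ℝ) + 8) ^ 2 / (ψ₀ / (82944 * (L : ℝ) ^ 10)) ^ 2 +
            2 * R + 8 * (2 * R) * ((finrank ℝ (GnoFibre L) : ℝ) + 8) / (ψ₀ / (82944 * (L : ℝ) ^ 10))) / Real.sqrt b +
          16 * ((finrank ℝ (GnoFibre L) : ℝ) + 8) / (ψ₀ / (82944 * (L : ℝ) ^ 10) * R ^ 2) / b) *
        ((2 * Real.pi / b) ^ ((finrank ℝ (GnoFibre L) : ℝ) / 2) * ∫ p : ℝ × ℝ, mbDensity a ε p) +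
      Real.exp (-(b * (ψ₀ / (82944 * (L : ℝ) ^ 10) * R ^ 2))) * ∫ η : GnoCoord L, gnoDensity η := by
  -- the measure space and the sockets
  set μρ : Measure (GnoCoord L) := (volume : Measure (GnoCoord L)).withDensity fun η => ENNReal.ofReal (gnoDensity η) with hμρ
  haveI : IsFiniteMeasure μρ := isFiniteMeasure_volume_gnoDensity
  have hL : (0 : ℝ) < (L : ℝ) := by exact_mod_cast NeZero.pos L
  have hlam : 0 < ψ₀ / (82944 * (L : ℝ) ^ 10) := by positivity
  obtain ⟨A, ρ, e, hAs, hAm, hρm, hem, -, hcoer, hf, hρb, hw, heb, hmain⟩ := gnoFibre_rescaled_sockets (L := L) ha ε hz hε hψ₀ hψ₁ hS1 hS2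
  obtain ⟨hTm, hchart⟩ := volume_gnoDensity_restrict_scaledTube_eq_map (L := L) (MeasurableSet.univ : MeasurableSet (univ : Set (ℝ × ℝ))) R
  obtain ⟨hw0pos, hw0m, hw0i⟩ := rescaledWeight_facts
  have hJm : Measurable fun q : (ℝ × ℝ) × GnoFibre L => (∏ i, |gnoFibreScale (L := L) q.1 i|) * gnoDensity (gnoFibreEquiv (q.1, gnoScale q.1 q.2)) :=
    (Finset.measurable_prod _ fun i _ => ((measurable_gnoFibreScale i).comp measurable_fst).abs).mul (measurable_gnoDensity.comp (measurable_gnoScaleChart (L := L)))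
  have hJ0 : ∀ q ∈ (univ : Set (ℝ × ℝ)) ×ˢ closedBall (0 : GnoFibre L) R, 0 ≤ (∏ i, |gnoFibreScale (L := L) q.1 i|) * gnoDensity (gnoFibreEquiv (q.1, gnoScale q.1 q.2)) :=
    fun q _ => mul_nonneg (Finset.prod_nonneg fun i _ => abs_nonneg _) (gnoDensity_pos _).le
  -- the off-tube bound (the rescaled chart is onto; far floor uniform on `ℝ²`)
  have hoff : ∀ x, x ∉ (fun q : (ℝ × ℝ) × GnoFibre L => gnoFibreEquiv (q.1, gnoScale q.1 q.2)) '' ((univ : Set (ℝ × ℝ)) ×ˢ closedBall (0 : GnoFibre L) R) →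
      ‖Real.exp (-(b * (gnoDeficit (fun _ => false) (fun _ => 1) a ε x - 0))) * (1 : ℝ)‖ ≤ Real.exp (-(b * (ψ₀ / (82944 * (L : ℝ) ^ 10) * R ^ 2))) := by
    intro x hx
    obtain ⟨⟨p, y⟩, rfl⟩ := gnoScaleChart_surjective (L := L) x
    have hy : R ≤ ‖y‖ := le_of_not_gt fun h => hx ⟨(p, y), ⟨mem_univ _, mem_closedBall_zero_iff.2 h.le⟩, rfl⟩
    have hfl := farFloor_gnoScale ha ε hε hψ₀ hψ₁ hS1 hS2 p y hR.le hR1 hy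
    rw [mul_one, Real.norm_eq_abs, abs_of_pos (Real.exp_pos _), sub_zero, Real.exp_le_exp, neg_le_neg_iff]
    exact mul_le_mul_of_nonneg_left hfl hb.le
  -- the generic √b law on `M = ℝ²`
  obtain ⟨-, hbd⟩ := laplaceMethod_quantitative_fibred_chart_cubic_offBound (X := GnoCoord L) (μ := μρ) (M := ℝ × ℝ) (ν := volume) (V := GnoFibre L)
    (Ψ := fun q : (ℝ × ℝ) × GnoFibre L => gnoFibreEquiv (q.1, gnoScale q.1 q.2))
    (J := fun q => (∏ i, |gnoFibreScale (L := L) q.1 i|) * gnoDensity (gnoFibreEquiv (q.1, gnoScale q.1 q.2)))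
    (f := gnoDeficit (fun _ => false) (fun _ => 1) a ε) (φ := fun _ => (1 : ℝ)) (f₀ := 0)
    (A := A) hAs hlam hcoer hAm (R := R) (A₃ := 1242000 * (L : ℝ) ^ 4) (D := 2 * R) (β := b) (Eoff := Real.exp (-(b * (ψ₀ / (82944 * (L : ℝ) ^ 10) * R ^ 2))))
    hR (by positivity) (by positivity) hb hsmall hDR (measurable_gnoScaleChart (L := L)) hTm hJm hJ0 hchart (measurable_gnoDeficit _ _ a ε) measurable_const hρm hem
    hw0m (fun p => (hw0pos p).le) hw0i
    (fun p y _ => hρb p y) (fun p y hy => heb R hR.le p y hy) (fun p y _ => hf p y) (fun p y _ => hw p y) (by positivity) (Filter.Eventually.of_forall hoff)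
  -- read the generic conclusion in the letters of the statement
  rw [measureReal_volume_gnoDensity_univ] at hbd
  have hmainI : ∫ p : ℝ × ℝ, (1 + p.1 ^ 2)⁻¹ * (1 + p.2 ^ 2)⁻¹ / Real.sqrt (LinearMap.det (A p)) = ∫ p : ℝ × ℝ, mbDensity a ε p :=
    integral_congr_ae (Filter.Eventually.of_forall hmain)
  have hlhs : ∫ x, Real.exp (-(b * (gnoDeficit (fun _ => false) (fun _ => 1) a ε x - 0))) * (1 : ℝ) ∂μρ =
      ∫ η : GnoCoord L, Real.exp (-(b * gnoDeficit (fun _ => false) (fun _ => 1) a ε η)) * gnoDensity η := by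
    rw [hμρ, integral_withDensity_eq_integral_toReal_smul (f := fun η : GnoCoord L => ENNReal.ofReal (gnoDensity η)) measurable_gnoDensity.ennreal_ofReal
      (Filter.Eventually.of_forall fun η => ENNReal.ofReal_lt_top)]
    refine integral_congr_ae (Filter.Eventually.of_forall fun η => ?_)
    dsimp only
    rw [ENNReal.toReal_ofReal (gnoDensity_pos η).le, smul_eq_mul, sub_zero, mul_one, mul_comm]
  rw [hmainI, hlhs] at hbd
  exact hbd

/-! ## §2 The plane estimate in the skeleton's letters -/

/-- The single dominating quantity of the plane estimate: with `U := 82944·L¹⁰·ψ₀⁻²`, `1∕λ ≤ U`, `m + 8 ≤ U`, `1242000L⁴ ≤ 15U`, `1 ≤ U` (`λ = ψ₀∕(82944L¹⁰)`).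
[folklore] -/
theorem plane_dominator_bounds {ψ₀ : ℝ} (hψ₀ : 0 < ψ₀) (hψ₁ : ψ₀ ≤ 1) :
    (ψ₀ / (82944 * (L : ℝ) ^ 10))⁻¹ ≤ 82944 * (L : ℝ) ^ 10 * (1 / ψ₀) ^ 2 ∧
    (finrank ℝ (GnoFibre L) : ℝ) + 8 ≤ 82944 * (L : ℝ) ^ 10 * (1 / ψ₀) ^ 2 ∧
    1242000 * (L : ℝ) ^ 4 ≤ 15 * (82944 * (L : ℝ) ^ 10 * (1 / ψ₀) ^ 2) ∧
    1 ≤ 82944 * (L : ℝ) ^ 10 * (1 / ψ₀) ^ 2 := by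
  have hL : (1 : ℝ) ≤ (L : ℝ) := by exact_mod_cast NeZero.one_le
  have hL4 : (1 : ℝ) ≤ (L : ℝ) ^ 4 := one_le_pow₀ hL
  have hL6 : (1 : ℝ) ≤ (L : ℝ) ^ 6 := one_le_pow₀ hL
  have hL10 : (L : ℝ) ^ 10 = (L : ℝ) ^ 6 * (L : ℝ) ^ 4 := by ring
  have hL10' : (1 : ℝ) ≤ (L : ℝ) ^ 10 := one_le_pow₀ hL
  have ht : 1 ≤ 1 / ψ₀ := one_le_one_div hψ₀ hψ₁
  have ht2 : 1 ≤ (1 / ψ₀) ^ 2 := one_le_pow₀ ht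
  have hU1 : 1 ≤ 82944 * (L : ℝ) ^ 10 * (1 / ψ₀) ^ 2 :=
    le_trans (by norm_num) (mul_le_mul (mul_le_mul (le_refl (82944 : ℝ)) hL10' zero_le_one (by norm_num)) ht2 zero_le_one (by positivity))
  refine ⟨?_, ?_, ?_, hU1⟩
  · rw [inv_div]
    calc 82944 * (L : ℝ) ^ 10 / ψ₀ = 82944 * (L : ℝ) ^ 10 * (1 / ψ₀) * 1 := by ring
      _ ≤ 82944 * (L : ℝ) ^ 10 * (1 / ψ₀) * (1 / ψ₀) := by gcongr
      _ = 82944 * (L : ℝ) ^ 10 * (1 / ψ₀) ^ 2 := by ring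
  · have h := (finrank_gnoFibre_add_eight_le (L := L)).2
    calc (finrank ℝ (GnoFibre L) : ℝ) + 8 ≤ 24 * (L : ℝ) ^ 4 := h
      _ ≤ 82944 * (L : ℝ) ^ 10 * 1 := by rw [hL10]; nlinarith [mul_le_mul_of_nonneg_left hL6 (by positivity : (0 : ℝ) ≤ (L : ℝ) ^ 4)]
      _ ≤ 82944 * (L : ℝ) ^ 10 * (1 / ψ₀) ^ 2 := by gcongr
  · calc 1242000 * (L : ℝ) ^ 4 ≤ 15 * (82944 * (L : ℝ) ^ 10 * 1) := by rw [hL10]; nlinarith [mul_le_mul_of_nonneg_left hL6 (by positivity : (0 : ℝ) ≤ (L : ℝ) ^ 4)]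
      _ ≤ 15 * (82944 * (L : ℝ) ^ 10 * (1 / ψ₀) ^ 2) := by gcongr

end Summit.QuantumFields.YangMills.Theorems.SwapVirialDeficit.BlowUpRing

namespace Summit.QuantumFields.YangMills.Theorems.SwapVirialDeficit.SectorLaplace

open Summit.QuantumFields.YangMills.Theorems.FemtoTransferGap
open Summit.QuantumFields.YangMills.Theorems.FemtoTransferGap.TT
open Summit.QuantumFields.YangMills.Theorems.VirialFluxGap.RingDeficit
open Summit.QuantumFields.YangMills.Theorems.SwapVirialDeficit.SwapRing
open Summit.QuantumFields.YangMills.Theorems.SwapVirialDeficit.BlowUpRing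

/-- ★★★ **STUB S2∞ OF THE (S)-SKELETON — THE BULK FIBRED LAPLACE ESTIMATE OVER THE WHOLE BASE PLANE, uniform in the cut, polynomial constants**
(`K := 234483·82944⁸`, `k := 80`): for every cut `ψ₀ ∈ (0,1]`, `b ≥ (K L^k ψ₀^{−k})²`, bulk hub `a ∈ HubBulk ψ₀` and good signs `ε`, the good-sign fibre integral at
the hub is the Morse–Bott main term `(2π∕b)^α·∫_{ℝ²} 𝔪(a,ε,p) dp` up to the relative error `K L^k ψ₀^{−k} b^{−1∕2}` and the off-tube term `(∫ρ)·e^{−b(ψ₀∕(K L^k))^k}` —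
the V₀-free twin of ✓`bulk_fibred` (no gnomonic-end cut; stub S5c disappears). [cite: Luscher1983, §2] [cite: HasenpflugRudolfSprungk2024, App. 4.1 Thm 16] -/
theorem bulk_fibred_plane : ∃ K : ℝ, 0 < K ∧ ∃ k : ℕ, ∀ (L : ℕ) [NeZero L] (ψ₀ b : ℝ), 0 < ψ₀ → ψ₀ ≤ 1 →
    (K * (L : ℝ) ^ k * (1 / ψ₀) ^ k) ^ 2 ≤ b → ∀ a : ℍ, a ∈ HubBulk ψ₀ → ∀ ε : GnoSign L, GoodSign ε →
      |(∫ η : GnoCoord L, Real.exp (-(b * gnoDeficit z₀ (fun _ => 1) a ε η)) * gnoDensity η) - (2 * Real.pi / b) ^ alpha L * ∫ p : ℝ × ℝ, mbDensity a ε p| ≤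
        K * (L : ℝ) ^ k * (1 / ψ₀) ^ k * b ^ (-(1 / 2 : ℝ)) * ((2 * Real.pi / b) ^ alpha L * ∫ p : ℝ × ℝ, mbDensity a ε p) +
          (∫ η : GnoCoord L, gnoDensity η) * Real.exp (-(b * (ψ₀ / (K * (L : ℝ) ^ k)) ^ k)) := by
  refine ⟨234483 * 82944 ^ 8, by positivity, 80, ?_⟩
  intro L _ ψ₀ b hψ₀ hψ₁ hb a haB ε hεG
  obtain ⟨ha, hS1, hS2⟩ : a ≠ 0 ∧ ψ₀ ≤ hubS1 a ∧ ψ₀ ≤ hubS2 a := haB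
  obtain ⟨hz, hε⟩ := hεG
  unfold alpha
  -- opaque letters for the dimension
  obtain ⟨mR, hmR⟩ : ∃ m : ℝ, (finrank ℝ (GnoFibre L) : ℝ) = m := ⟨_, rfl⟩
  rw [hmR]
  obtain ⟨hm8pos, hm8le⟩ : 0 < mR + 8 ∧ mR + 8 ≤ 24 * (L : ℝ) ^ 4 := by rw [← hmR]; exact finrank_gnoFibre_add_eight_le (L := L)
  have hm8ge : 8 ≤ mR + 8 := by rw [← hmR]; have := Nat.cast_nonneg (α := ℝ) (finrank ℝ (GnoFibre L)); linarith
  -- the letters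
  set ℓ : ℝ := (L : ℝ) with hℓ
  set t : ℝ := 1 / ψ₀ with ht
  set U : ℝ := 82944 * ℓ ^ 10 * t ^ 2 with hU
  set μ' : ℝ := ψ₀ / (82944 * ℓ ^ 10) with hμ'
  set A₃ : ℝ := 1242000 * ℓ ^ 4 with hA₃
  set R : ℝ := μ' / (8 * (mR + 8) * A₃) with hRdef
  set K₀ : ℝ := 234483 * 82944 ^ 8 with hK₀
  have hL1 : (1 : ℝ) ≤ ℓ := by rw [hℓ]; exact_mod_cast NeZero.one_le
  have ht1 : 1 ≤ t := by rw [ht]; exact one_le_one_div hψ₀ hψ₁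
  -- threshold consequences (then `hb` is no longer needed)
  have hK1 : (1 : ℝ) ≤ K₀ := by rw [hK₀]; norm_num
  have hKℓt : 1 ≤ K₀ * ℓ ^ 80 * t ^ 80 := by
    calc (1 : ℝ) = 1 * 1 * 1 := by ring
      _ ≤ K₀ * ℓ ^ 80 * t ^ 80 := mul_le_mul (mul_le_mul hK1 (one_le_pow₀ hL1) zero_le_one (by positivity)) (one_le_pow₀ ht1) zero_le_one (by positivity)
  have hb1 : 1 ≤ b := le_trans (one_le_pow₀ hKℓt) hb
  clear hb
  have hb0 : 0 < b := lt_of_lt_of_le one_pos hb1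
  have hsb : 1 ≤ Real.sqrt b := by rw [← Real.sqrt_one]; exact Real.sqrt_le_sqrt hb1
  obtain ⟨hμinv, hm8U, hA₃U, hU1⟩ := plane_dominator_bounds (L := L) hψ₀ hψ₁
  rw [hmR] at hm8U
  have hU0 : 0 < U := lt_of_lt_of_le one_pos hU1
  have hμpos : 0 < μ' := by rw [hμ']; positivity
  have hA₃pos : 0 < A₃ := by rw [hA₃]; positivity
  have hA₃1 : 2 ≤ A₃ := by
    rw [hA₃]
    have : (1 : ℝ) ≤ ℓ ^ 4 := one_le_pow₀ hL1
    calc (2 : ℝ) ≤ 1242000 * 1 := by norm_num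
      _ ≤ 1242000 * ℓ ^ 4 := by gcongr
  have hμU : 1 / U ≤ μ' := by
    rw [one_div, ← inv_inv μ']
    exact (inv_le_inv₀ hU0 (inv_pos.2 hμpos)).2 hμinv
  have hμ1 : μ' ≤ 1 := by
    rw [hμ', div_le_one (by positivity)]
    have h2 : (1 : ℝ) ≤ ℓ ^ 10 := one_le_pow₀ hL1
    calc ψ₀ ≤ 1 := hψ₁
      _ = 1 * 1 := by ring
      _ ≤ 82944 * ℓ ^ 10 := mul_le_mul (by norm_num) h2 zero_le_one (by norm_num)
  -- radius bookkeeping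
  have h8 : 128 ≤ 8 * (mR + 8) * A₃ := by
    calc (128 : ℝ) = 8 * 8 * 2 := by norm_num
      _ ≤ 8 * (mR + 8) * A₃ := mul_le_mul (mul_le_mul_of_nonneg_left hm8ge (by norm_num)) hA₃1 zero_le_two (by positivity)
  have hRpos : 0 < R := by rw [hRdef]; positivity
  have hRhalf : R ≤ 1 / 2 := by
    rw [hRdef, div_le_iff₀ (by positivity)]
    calc μ' ≤ 1 := hμ1
      _ ≤ 1 / 2 * (8 * (mR + 8) * A₃) := by linarith
  have hR1 : R ≤ 1 := hRhalf.trans (by norm_num)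
  have hsmall : 1242000 * (L : ℝ) ^ 4 * R ≤ μ' / (8 * (mR + 8)) := by
    rw [← hℓ, ← hA₃, hRdef]
    rw [show A₃ * (μ' / (8 * (mR + 8) * A₃)) = μ' / (8 * (mR + 8)) by field_simp]
  have hDR : 2 * R * R ≤ 1 := by
    calc 2 * R * R ≤ 2 * (1 / 2) * 1 := by
          refine mul_le_mul (mul_le_mul_of_nonneg_left hRhalf (by norm_num)) hR1 hRpos.le (by norm_num)
      _ = 1 := by norm_num
  -- (i) the relative error is dominated by `K₀ ℓ^80 t^80 / √b`
  have hT1 : 16 * (1242000 * (L : ℝ) ^ 4) * (mR + 8) / μ' ≤ 240 * U ^ 3 := by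
    rw [← hℓ, ← hA₃, div_eq_mul_inv]
    calc 16 * A₃ * (mR + 8) * μ'⁻¹ ≤ 16 * (15 * U) * U * U := by gcongr
      _ = 240 * U ^ 3 := by ring
  have hT2 : 256 * (1242000 * (L : ℝ) ^ 4) * (mR + 8) ^ 2 / μ' ^ 2 ≤ 3840 * U ^ 5 := by
    rw [← hℓ, ← hA₃, div_eq_mul_inv, ← inv_pow]
    calc 256 * A₃ * (mR + 8) ^ 2 * μ'⁻¹ ^ 2 ≤ 256 * (15 * U) * U ^ 2 * U ^ 2 := by gcongr
      _ = 3840 * U ^ 5 := by ring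
  have hT3 : 2 * R ≤ 2 := by
    calc 2 * R ≤ 2 * 1 := by gcongr
      _ = 2 := by ring
  have hT4 : 8 * (2 * R) * (mR + 8) / μ' ≤ 1 := by
    rw [hRdef]
    rw [show 8 * (2 * (μ' / (8 * (mR + 8) * A₃))) * (mR + 8) / μ' = 2 / A₃ by field_simp]
    rw [div_le_one hA₃pos]
    exact hA₃1
  have hT5 : 16 * (mR + 8) / (μ' * R ^ 2) ≤ 230400 * U ^ 8 := by
    rw [hRdef]
    rw [show 16 * (mR + 8) / (μ' * (μ' / (8 * (mR + 8) * A₃)) ^ 2) = 1024 * (mR + 8) ^ 3 * A₃ ^ 2 * μ'⁻¹ ^ 3 by field_simp; ring]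
    calc 1024 * (mR + 8) ^ 3 * A₃ ^ 2 * μ'⁻¹ ^ 3 ≤ 1024 * U ^ 3 * (15 * U) ^ 2 * U ^ 3 := by gcongr
      _ = 230400 * U ^ 8 := by ring
  have hU3 : U ^ 3 ≤ U ^ 8 := pow_le_pow_right₀ hU1 (by norm_num)
  have hU5 : U ^ 5 ≤ U ^ 8 := pow_le_pow_right₀ hU1 (by norm_num)
  have hU8 : 1 ≤ U ^ 8 := one_le_pow₀ hU1
  have hK3 : (16 * (1242000 * (L : ℝ) ^ 4) * (mR + 8) / μ' + 256 * (1242000 * (L : ℝ) ^ 4) * (mR + 8) ^ 2 / μ' ^ 2 + 2 * R + 8 * (2 * R) * (mR + 8) / μ') ≤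
      4083 * U ^ 8 := by linarith
  have hrel : (16 * (1242000 * (L : ℝ) ^ 4) * (mR + 8) / μ' + 256 * (1242000 * (L : ℝ) ^ 4) * (mR + 8) ^ 2 / μ' ^ 2 + 2 * R + 8 * (2 * R) * (mR + 8) / μ') / Real.sqrt b +
      16 * (mR + 8) / (μ' * R ^ 2) / b ≤ K₀ * ℓ ^ 80 * t ^ 80 * b ^ (-(1 / 2 : ℝ)) := by
    have hsq : b ^ (-(1 / 2 : ℝ)) = 1 / Real.sqrt b := by
      rw [Real.rpow_neg hb0.le, Real.sqrt_eq_rpow, inv_eq_one_div]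
    have hbinv : 1 / b ≤ 1 / Real.sqrt b := by
      refine one_div_le_one_div_of_le (by positivity) ?_
      calc Real.sqrt b = Real.sqrt b * 1 := (mul_one _).symm
        _ ≤ Real.sqrt b * Real.sqrt b := by gcongr
        _ = b := Real.mul_self_sqrt hb0.le
    have hU8le : U ^ 8 ≤ 82944 ^ 8 * ℓ ^ 80 * t ^ 80 := by
      rw [hU, mul_pow, mul_pow, ← pow_mul, ← pow_mul]
      have : t ^ (2 * 8) ≤ t ^ 80 := pow_le_pow_right₀ ht1 (by norm_num)
      have h80 : ℓ ^ (10 * 8) = ℓ ^ 80 := by norm_num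
      rw [h80]; gcongr
    have hT5nn : 0 ≤ 16 * (mR + 8) / (μ' * R ^ 2) := by positivity
    have hK3nn : 0 ≤ (16 * (1242000 * (L : ℝ) ^ 4) * (mR + 8) / μ' + 256 * (1242000 * (L : ℝ) ^ 4) * (mR + 8) ^ 2 / μ' ^ 2 + 2 * R + 8 * (2 * R) * (mR + 8) / μ') := by
      rw [← hℓ]; positivity
    calc _ ≤ 4083 * U ^ 8 / Real.sqrt b + 230400 * U ^ 8 / b := by gcongr
      _ = 4083 * U ^ 8 * (1 / Real.sqrt b) + 230400 * U ^ 8 * (1 / b) := by ring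
      _ ≤ 4083 * U ^ 8 * (1 / Real.sqrt b) + 230400 * U ^ 8 * (1 / Real.sqrt b) := by gcongr
      _ = 234483 * U ^ 8 * (1 / Real.sqrt b) := by ring
      _ ≤ 234483 * (82944 ^ 8 * ℓ ^ 80 * t ^ 80) * (1 / Real.sqrt b) := by gcongr
      _ = K₀ * ℓ ^ 80 * t ^ 80 * b ^ (-(1 / 2 : ℝ)) := by rw [hsq, hK₀]; ring
  -- (ii) the off-tube exponent
  have hexp : Real.exp (-(b * (μ' * R ^ 2))) ≤ Real.exp (-(b * (ψ₀ / (K₀ * (L : ℝ) ^ 80)) ^ 80)) := by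
    rw [Real.exp_le_exp, neg_le_neg_iff, ← hℓ]
    refine mul_le_mul_of_nonneg_left ?_ hb0.le
    have hx0 : 0 ≤ ψ₀ / (K₀ * ℓ ^ 80) := by positivity
    have hx1 : ψ₀ / (K₀ * ℓ ^ 80) ≤ 1 := by
      rw [div_le_one (by positivity)]
      calc ψ₀ ≤ 1 := hψ₁
        _ = 1 * 1 := by ring
        _ ≤ K₀ * ℓ ^ 80 := mul_le_mul hK1 (one_le_pow₀ hL1) zero_le_one (by positivity)
    have h14 : (ψ₀ / (K₀ * ℓ ^ 80)) ^ 80 ≤ (ψ₀ / (K₀ * ℓ ^ 80)) ^ 14 := pow_le_pow_of_le_one hx0 hx1 (by norm_num)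
    have hden : (14400 : ℝ) * 82944 ^ 7 * ℓ ^ 70 ≤ K₀ ^ 14 * ℓ ^ (80 * 14) := by
      have h1 : (14400 : ℝ) * 82944 ^ 7 ≤ K₀ ^ 14 := by
        calc (14400 : ℝ) * 82944 ^ 7 ≤ K₀ := by rw [hK₀]; norm_num
          _ = K₀ ^ 1 := (pow_one _).symm
          _ ≤ K₀ ^ 14 := pow_le_pow_right₀ hK1 (by norm_num)
      have h2 : ℓ ^ 70 ≤ ℓ ^ (80 * 14) := pow_le_pow_right₀ hL1 (by norm_num)
      exact mul_le_mul h1 h2 (by positivity) (by positivity)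
    have hstep : (ψ₀ / (K₀ * ℓ ^ 80)) ^ 14 ≤ ψ₀ ^ 14 / (14400 * 82944 ^ 7 * ℓ ^ 70) := by
      rw [div_pow, mul_pow, ← pow_mul]
      exact div_le_div_of_nonneg_left (by positivity) (by positivity) hden
    have hUeq : ψ₀ ^ 14 / (14400 * 82944 ^ 7 * ℓ ^ 70) = 1 / (14400 * U ^ 7) := by
      rw [hU, ht]; field_simp
    have hlow : 1 / (14400 * U ^ 7) ≤ μ' * R ^ 2 := by
      rw [hRdef]
      rw [show μ' * (μ' / (8 * (mR + 8) * A₃)) ^ 2 = μ' ^ 3 / (64 * (mR + 8) ^ 2 * A₃ ^ 2) by field_simp; ring]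
      rw [div_le_div_iff₀ (by positivity) (by positivity)]
      have hUμ : 1 ≤ μ' * U := (div_le_iff₀ hU0).1 hμU
      have hUμ3 : 1 ≤ (μ' * U) ^ 3 := one_le_pow₀ hUμ
      calc 1 * (64 * (mR + 8) ^ 2 * A₃ ^ 2) ≤ 1 * (64 * U ^ 2 * (15 * U) ^ 2) := by gcongr
        _ = 14400 * U ^ 4 * 1 := by ring
        _ ≤ 14400 * U ^ 4 * (μ' * U) ^ 3 := by gcongr
        _ = μ' ^ 3 * (14400 * U ^ 7) := by ring
    calc (ψ₀ / (K₀ * ℓ ^ 80)) ^ 80 ≤ (ψ₀ / (K₀ * ℓ ^ 80)) ^ 14 := h14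
      _ ≤ ψ₀ ^ 14 / (14400 * 82944 ^ 7 * ℓ ^ 70) := hstep
      _ = 1 / (14400 * U ^ 7) := hUeq
      _ ≤ μ' * R ^ 2 := hlow
  -- the core estimate (letters: `finrank ↦ mR`)
  have hcore := bulk_fibred_plane_core (L := L) ha ε hz hε hψ₀ hψ₁ hS1 hS2 hRpos hR1 (by rw [hmR]; exact hsmall) hDR hb0
  rw [hmR] at hcore
  -- the main term is non-negative
  set Main : ℝ := (2 * Real.pi / b) ^ (mR / 2) * ∫ p : ℝ × ℝ, mbDensity a ε p with hMain
  have hMain0 : 0 ≤ Main := by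
    rw [hMain]
    exact mul_nonneg (Real.rpow_nonneg (by positivity) _) (integral_nonneg fun p => mbDensity_nonneg a ε p)
  -- assemble
  have hρ0 : 0 ≤ ∫ η : GnoCoord L, gnoDensity η := integral_nonneg fun η => (gnoDensity_pos η).le
  calc _ ≤ _ := hcore
    _ ≤ K₀ * ℓ ^ 80 * t ^ 80 * b ^ (-(1 / 2 : ℝ)) * Main + (∫ η : GnoCoord L, gnoDensity η) * Real.exp (-(b * (ψ₀ / (K₀ * (L : ℝ) ^ 80)) ^ 80)) := by
        rw [mul_comm (Real.exp _)]
        exact add_le_add (mul_le_mul_of_nonneg_right hrel hMain0) (mul_le_mul_of_nonneg_left hexp hρ0)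

end Summit.QuantumFields.YangMills.Theorems.SwapVirialDeficit.SectorLaplace

end
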